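import Summits.QuantumFields.YangMills.Theorems.FluctuationComparisonRegPrIntLS2BetaCritMQuaternionRead
import Summits.QuantumFields.YangMills.Theorems.FluctuationComparisonRegPrIntLClassicalPerHeightSteps
import Summits.QuantumFields.YangMills.Theorems.FluctuationComparisonRegPrIntLS2BetaQuaternionReadFibreIdentity
import HarnessLib

/-!
# S2β · Q7 — THE TOWER CHAIN RULE FOR `DMq` AND THE EXACT SECOND-ORDER TELESCOPE (the k-step remainder ∕ fibre identity of AVG₂♭-ax_q, level by level)

Cell `ym3-torus` (rung R3 = continuum `SU(2)` YM₃ on T³ at fixed lattice data — NOT d = 4, NOT infinite volume, NOT a mass gap, NOT Clay).  Width seat `ym3-torus-px5` (gen 23);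
crux `stmt-QuantumFields-20520`, LINE g18-1 S2β: «CRIT-ax» (✓p823293) ⟸ «MULT♭-ax» ⟸ ✓p825995 `multAx_of_letters hT G Ax hR hM` ⟸ {Thm-1 pair, (RINV-curl)_q ✓p827199, AVG₂♭-ax_q =
`hM`}; `--kind proof --supports stmt-QuantumFields-20520 --as helper`, count-neutral, DEFINITION-FREE (0 `def`, 0 `instance`, 0 `notation`, 0 `sorry`, default heartbeats).
OBJECTS (✓p825180, written out in every statement): `Mq_{J←K}(U₀) ζ B := imVec (su2Quat (D_{J,K}(ℓ ↦ expPoint (ζ ℓ)·U₀ ℓ) B · (D_{J,K} U₀ B)⁻¹))` (`D_{J,K}` = lit `descendTo F ℰp J K`),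
`DMq_{J←K}(U₀) := fderiv ℝ (Mq_{J←K}(U₀)) 0` — the map AVG₂♭-ax_q feeds with the imVec chord `η ℓ = imVec (su2Quat (U ℓ·U₀ ℓ⁻¹))` of a fibre mate `U` (UV3-NODE §89.2).

WHAT IS PROVED (sorry-free).
* §0 `histGood_of_le`, `descendTo_mem_histGood` (`D_{I,K}U₀` of a good history is a good history of the shorter tower; ✓`descendTo_descendTo`, ✓`histGood_iff_descendTo`), `imVec_su2Quat_one`.
* §1 ★★`qRead_tower_eventuallyEq` — near `0`, **`Mq_{J←K}(U₀) = Mq_{J←I}(D_{I,K}U₀) ∘ E⁻¹ ∘ Mc_{I←K}(U₀)`** (`Mc` = the log-chart read of ✓`hasStrictFDerivAt_chartRead_descendTo_expPoint`; window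
  identity `expPoint (E⁻¹(Λ W) b) = W b` as in ✓`qRead_eventuallyEq`, then `D_{J,I} ∘ D_{I,K} = D_{J,K}`); ★★★`fderiv_qRead_tower` — **`DMq_{J←K}(U₀) = DMq_{J←I}(D_{I,K}U₀) ∘L DMq_{I←K}(U₀)`**
  (`J ≤ I ≤ K`, Q1's guard at `(J,K)`); `fderiv_qRead_self` — **`DMq_{K←K} = id`**.
* §2 ★★★`qRead_tower_telescope` — over `K = J + k`, for EVERY family `x_t ∈ (PBond (F.P (J+t)) 0 → ℝ³)`:
  **`x_0 − DMq_{J←K}(U₀) x_k = Σ_{t<k} DMq_{J←J+t}(D_{J+t,K}U₀) (x_t − DMq_{J+t←J+t+1}(D_{J+t+1,K}U₀) x_{t+1})`** (a `Finset.range k` sum, summand guarded by `t < k`).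
* §3 ★★`qRead_apply_logVec_chord` — **`Mq_{J←K}(V)(ℓ ↦ logVec (su2Quat (W ℓ·V ℓ⁻¹))) = (B ↦ imVec (su2Quat (D_{J,K}W B·D_{J,K}V B⁻¹)))`** for ANY pair (lit ✓`expPoint_logVec`);
  ★★★`chord_sub_fderiv_qRead_chord_eq_sum` — for ANY partner `W` of a good history `U₀`, level chords `η⁽ᵗ⁾ ℓ := imVec (su2Quat (D_{J+t,K}W ℓ·D_{J+t,K}U₀ ℓ⁻¹))`:
  **`η⁽⁰⁾ − DMq_{J←K}(U₀) η⁽ᵏ⁾ = Σ_{t<k} DMq_{J←J+t}(D_{J+t,K}U₀) (η⁽ᵗ⁾ − DMq_{J+t←J+t+1}(D_{J+t+1,K}U₀) η⁽ᵗ⁺¹⁾)`** — for `W = expPoint ζ • U₀` the left side is the vector of px17 g22's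
  TAYLOR♭_q (`Mq ζ − DMq (sinc‖ζ‖•ζ)`, ✓`…QuaternionReadFibreIdentity.avg2_of_taylor`): the k-step second-order remainder IS the telescope of propagated ONE-STEP linearisation defects
  «actual coarse chord minus linearised one-step average of the fine chord», each bracket being what the (β) brick ([Balaban1985Averaging] Prop. 3 (123) for the tree's average) must
  bound; ★★★`fderiv_qRead_chord_eq_sum_of_mem_fibre` — **THE k-STEP FIBRE IDENTITY**: for a fibre mate `U` (px17 g22's Q6 ✓`qRead_eq_zero_of_mem_fibre` kills `η⁽⁰⁾`),
  **`DMq_{J←K}(U₀) η⁽ᵏ⁾ = Σ_{t<k} DMq_{J←J+t}(D_{J+t,K}U₀) (DMq_{J+t←J+t+1}(D_{J+t+1,K}U₀) η⁽ᵗ⁺¹⁾ − η⁽ᵗ⁾)`**, `η⁽ᵏ⁾` = AVG₂♭-ax_q's OWN input (no chart conversion at the k-step level).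

HONEST SCOPE.  Chain-rule ∕ telescoping BOOKKEEPING over ✓p825180 and the descent tower law; zero analytic content of Bałaban's ((127)–(128), (148)–(149) of [Balaban1985Averaging]
run print's induction over the same composition — the ESTIMATES are not here); AVG₂♭-ax_q is NOT proved, only read level by level; «MULT♭-ax», «CRIT-ax», (D-ax)∕(F-ax), GAP♯∘
(`stub_uniformFibreGapOrbit`, registry 3732b7df UNTOUCHED), S2β, the five registered stubs, 20520, 19936, 19200, `YM3TorusSU2` NOT proved; no summit statement is proved by a helper;
rung R3 — NOT d = 4, NOT infinite volume, NOT a mass gap, NOT Clay; the Yang–Mills mass gap is NOT proved.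

References: T. Bałaban, CMP **98** (1985) 17–51 [Balaban1985Averaging] (Prop. 3 (122)–(124) p.36, (127)–(128) p.37, (139)–(149) pp.39–40); CMP **109** (1987) 249–301
[Balaban1987RG1] ((0.4), (0.11) p.253: `Ū^k = M^k(U)` across towers); CMP **102** (1985) 255–275 [Balaban1985UV3] ((7) p.257, p.260: the chart `A ↦ exp iA`).
-/

set_option autoImplicit false

noncomputable section

open scoped Matrix.Norms.L2Operator Topology RealInnerProductSpace Quaternion
open Filter Set Function
open Literature.MathematicalPhysics.QuantumLattice (su2Quat fundamentalRep fundamentalRep_apply)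
open Literature.MathematicalPhysics.QuantumFieldTheory.Balaban1983to89
open Literature.MathematicalPhysics.QuantumFieldTheory.Balaban1983to89.HaarExponentialChart
open Literature.MathematicalPhysics.QuantumFieldTheory.Balaban1983to89.HaarExponentialChart.IsChartRep
open Literature.MathematicalPhysics.QuantumFieldTheory.Balaban1983to89.ExpMeanLog (expMeanLogSU deltaSU deltaSU_pos)
open Literature.MathematicalPhysics.QuantumFieldTheory.Balaban1983to89.Node00
open Literature.MathematicalPhysics.QuantumFieldTheory.Balaban1983to89.T3ContinuumYM3Torus
open Literature.MathematicalPhysics.QuantumFieldTheory.Balaban1983to89.T3UnitLawDensityEML (ℰp)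
open Literature.MathematicalPhysics.QuantumFieldTheory.Balaban1983to89.T3UnitScaleTilt
open Literature.MathematicalPhysics.QuantumFieldTheory.Balaban1983to89.T3TiltDescent
open Literature.MathematicalPhysics.QuantumFieldTheory.Balaban1983to89.T3ConstrainedMinimiser (fibre)
open Literature.MathematicalPhysics.QuantumFieldTheory.Balaban1983to89.T3DescentFibreTower
open Literature.MathematicalPhysics.QuantumFieldTheory.Balaban1983to89.T4HaarSU2ExpChart (expPoint expPoint_zero imQuat su2Quat_expPoint)
open Literature.MathematicalPhysics.QuantumFieldTheory.Balaban1983to89.T4HaarSU2Translate (su2Quat_one)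
open Literature.MathematicalPhysics.QuantumFieldTheory.Balaban1983to89.T4ExpWindowSmallField (imVec logVec expPoint_logVec)
open Literature.MathematicalPhysics.QuantumFieldTheory.Balaban1983to89.B10Eq18SigmaSU2 (su2Coord)
open Literature.MathematicalPhysics.QuantumFieldTheory.Balaban1983to89.B10Eq18SigmaSU2Haar (rev)
open Literature.MathematicalPhysics.QuantumFieldTheory.Balaban1983to89.T4Continuum
open Summit.QuantumFields.YangMills.Theorems.FluctuationComparisonRegPrIntLS2BetaChartReadDescentOntoExpPoint
  (hasStrictFDerivAt_chartRead_descendTo_expPoint continuousAt_descendTo_expPoint relLogChart_window_mem_nhds su2Coord_rev_mem_lie expPoint_eq_expChart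
    exists_coordEquiv chartRead_descendTo_expPoint_apply_zero)
open Summit.QuantumFields.YangMills.Theorems.FluctuationComparisonRegPrIntLS2BetaCritMQuaternionRead
  (hasStrictFDerivAt_pi_imVec_su2Quat_expPoint hasStrictFDerivAt_qRead_descendTo)
open Summit.QuantumFields.YangMills.Theorems.FluctuationComparisonRegPrIntLClassicalPerHeightSteps (histGood_iff_descendTo)
open Summit.QuantumFields.YangMills.Theorems.FluctuationComparisonRegPrIntLS2BetaQuaternionReadFibreIdentity (qRead_eq_zero_of_mem_fibre expPoint_logChord_mul)

namespace Summit.QuantumFields.YangMills.Theorems.FluctuationComparisonRegPrIntLS2BetaQuaternionReadTowerTelescope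

variable {F : T3Family}

/-! ## §0 Bookkeeping: good histories down the tower; `imVec (su2Quat 1) = 0` -/

section Bookkeeping

/-- More free top steps is a weaker history condition: `histGood θ K J ⊆ histGood θ K I` for `J ≤ I`. [cite: Balaban1985UV3, (7) p.257 (bookkeeping)] -/
theorem histGood_of_le {θ : ℕ → ℝ} {J I K : ℕ} (hJI : J ≤ I) {U₀ : GaugeField (F.P K) 0 (SU 2)} (hUg : U₀ ∈ histGood F ℰp θ K J) :
    U₀ ∈ histGood F ℰp θ K I := by
  rw [histGood_iff_descendTo] at hUg ⊢
  exact fun n hIn hnK => hUg n (hJI.trans hIn) hnK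

/-- **THE DESCENDED BASE OF A GOOD HISTORY IS A GOOD HISTORY OF THE SHORTER TOWER**: `U₀ ∈ histGood θ K J`, `I ≤ K` ⇒ `D_{I,K}U₀ ∈ histGood θ I J`
(`D_{n,I} ∘ D_{I,K} = D_{n,K}`, lit ✓`descendTo_descendTo`). [cite: Balaban1987RG1, (0.11) p.253; Balaban1985UV3, (7) p.257] -/
theorem descendTo_mem_histGood {θ : ℕ → ℝ} {J I K : ℕ} (hIK : I ≤ K) {U₀ : GaugeField (F.P K) 0 (SU 2)}
    (hUg : U₀ ∈ histGood F ℰp θ K J) : descendTo F ℰp I K hIK U₀ ∈ histGood F ℰp θ I J := by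
  rw [histGood_iff_descendTo] at hUg ⊢
  intro n hJn hnI
  rw [descendTo_descendTo]
  exact hUg n hJn (hnI.trans hIK)

/-- `imVec (su2Quat 1) = 0` (the chord of a pair of equal group elements). [folklore] -/
theorem imVec_su2Quat_one : imVec (su2Quat (1 : SU 2)) = 0 := by
  rw [su2Quat_one]
  ext i
  fin_cases i <;> simp [imVec]

end Bookkeeping

/-! ## §1 The tower factorisation of the quaternion-read descent near `0` and the tower chain rule for `DMq` -/

section ChainRule

/-- ★★ **NEAR `ζ = 0` THE `(J,K)` QUATERNION-READ DESCENT FACTORS THROUGH LEVEL `I`**: `Mq_{J←K}(U₀) = Mq_{J←I}(D_{I,K}U₀) ∘ E⁻¹ ∘ Mc_{I←K}(U₀)` eventually in `𝓝 0`, for every Pauli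
coordinate equivalence `E` (guard at `(I,K]` only: on the window `Θ(Λ g) = g`, ✓`expChart_logChart`, reached by ✓`continuousAt_descendTo_expPoint`; then `D_{J,I}(D_{I,K}Y) = D_{J,K}Y`).
[cite: Balaban1987RG1, (0.4), (0.11) p.253; Balaban1985UV3, p. 260 (bookkeeping)] -/
theorem qRead_tower_eventuallyEq {J I K : ℕ} (hJI : J ≤ I) (hIK : I ≤ K) {θ : ℕ → ℝ} (hθ0 : ∀ i, 0 ≤ θ i)
    (hθδ : ∀ i, I < i → i ≤ K → (((5 * F.L : ℕ) : ℝ) ^ 2 / 4) * θ i < deltaSU (Fin 2))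
    {U₀ : GaugeField (F.P K) 0 (SU 2)} (hUg : U₀ ∈ histGood F ℰp θ K I)
    (E : (PBond (F.P I) 0 → EuclideanSpace ℝ (Fin 3)) ≃L[ℝ] (PBond (F.P I) 0 → (specialUnitaryLogChart (Fin 2)).lie))
    (hE : ∀ y B, E y B = ⟨su2Coord (rev (y B)), su2Coord_rev_mem_lie (y B)⟩) :
    (fun (ζ : PBond (F.P K) 0 → EuclideanSpace ℝ (Fin 3)) (B : PBond (F.P J) 0) =>
        imVec (su2Quat (descendTo F ℰp J K (hJI.trans hIK) (fun ℓ => expPoint (ζ ℓ) * U₀ ℓ) B * (descendTo F ℰp J K (hJI.trans hIK) U₀ B)⁻¹))) =ᶠ[𝓝 0]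
      (fun (y : PBond (F.P I) 0 → EuclideanSpace ℝ (Fin 3)) (B : PBond (F.P J) 0) =>
          imVec (su2Quat (descendTo F ℰp J I hJI (fun b => expPoint (y b) * descendTo F ℰp I K hIK U₀ b) B *
            (descendTo F ℰp J I hJI (descendTo F ℰp I K hIK U₀) B)⁻¹))) ∘ ⇑E.symm ∘
        (fun (ζ : PBond (F.P K) 0 → EuclideanSpace ℝ (Fin 3)) (b : PBond (F.P I) 0) =>
          (isChartRep_specialUnitaryGroup (n := Fin 2)).logChart
            (descendTo F ℰp I K hIK (fun ℓ => expPoint (ζ ℓ) * U₀ ℓ) b * (descendTo F ℰp I K hIK U₀ b)⁻¹)) := by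
  have hcont := continuousAt_descendTo_expPoint (F := F) hIK hθ0 hθδ hUg
  have h0 : (fun ℓ => expPoint ((0 : PBond (F.P K) 0 → EuclideanSpace ℝ (Fin 3)) ℓ) * U₀ ℓ : GaugeField (F.P K) 0 (SU 2)) = U₀ := by
    funext ℓ; rw [Pi.zero_apply, expPoint_zero, one_mul]
  have hO := relLogChart_window_mem_nhds (descendTo F ℰp I K hIK U₀)
  have hT : Tendsto (fun ζ : PBond (F.P K) 0 → EuclideanSpace ℝ (Fin 3) =>
      descendTo F ℰp I K hIK (fun ℓ => expPoint (ζ ℓ) * U₀ ℓ : GaugeField (F.P K) 0 (SU 2))) (𝓝 0) (𝓝 (descendTo F ℰp I K hIK U₀)) := by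
    have h : Tendsto (fun ζ : PBond (F.P K) 0 → EuclideanSpace ℝ (Fin 3) =>
        descendTo F ℰp I K hIK (fun ℓ => expPoint (ζ ℓ) * U₀ ℓ : GaugeField (F.P K) 0 (SU 2))) (𝓝 0)
        (𝓝 ((fun ζ : PBond (F.P K) 0 → EuclideanSpace ℝ (Fin 3) =>
          descendTo F ℰp I K hIK (fun ℓ => expPoint (ζ ℓ) * U₀ ℓ : GaugeField (F.P K) 0 (SU 2))) 0)) := hcont.tendsto
    have hval : (fun ζ : PBond (F.P K) 0 → EuclideanSpace ℝ (Fin 3) =>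
          descendTo F ℰp I K hIK (fun ℓ => expPoint (ζ ℓ) * U₀ ℓ : GaugeField (F.P K) 0 (SU 2))) 0 = descendTo F ℰp I K hIK U₀ := by
      show descendTo F ℰp I K hIK (fun ℓ => expPoint ((0 : PBond (F.P K) 0 → EuclideanSpace ℝ (Fin 3)) ℓ) * U₀ ℓ) = _; rw [h0]
    rwa [hval] at h
  filter_upwards [hT.eventually hO] with ζ hζ
  -- the intermediate field, re-charted at level `I`, IS the descended field
  have hW : (fun b : PBond (F.P I) 0 => expPoint ((E.symm (fun b' : PBond (F.P I) 0 =>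
        (isChartRep_specialUnitaryGroup (n := Fin 2)).logChart
          (descendTo F ℰp I K hIK (fun ℓ => expPoint (ζ ℓ) * U₀ ℓ) b' * (descendTo F ℰp I K hIK U₀ b')⁻¹))) b) *
        descendTo F ℰp I K hIK U₀ b : GaugeField (F.P I) 0 (SU 2)) =
      descendTo F ℰp I K hIK (fun ℓ => expPoint (ζ ℓ) * U₀ ℓ) := by
    funext b
    rw [expPoint_eq_expChart, ← hE (E.symm _) b, E.apply_symm_apply]
    have hρ : ‖fundamentalRep (Fin 2) (descendTo F ℰp I K hIK (fun ℓ => expPoint (ζ ℓ) * U₀ ℓ) b * (descendTo F ℰp I K hIK U₀ b)⁻¹) - 1‖ <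
        innerRadius (specialUnitaryLogChart (Fin 2)) := by
      rw [fundamentalRep_apply]; exact hζ b
    rw [(isChartRep_specialUnitaryGroup (n := Fin 2)).expChart_logChart hρ, inv_mul_cancel_right]
  funext B
  simp only [Function.comp_apply]
  rw [hW, descendTo_descendTo, descendTo_descendTo]

/-- ★★★ **THE TOWER CHAIN RULE `DMq_{J←K}(U₀) = DMq_{J←I}(D_{I,K}U₀) ∘L DMq_{I←K}(U₀)`** for `J ≤ I ≤ K` at a good history `U₀` (Q1's guard at `(J,K)`: `0 ≤ θ`,
`(5L)²∕4·θ_i ≤ α` on `J < i ≤ K`, `α ≤ 1∕24`, `α < δ_{SU(2)}`, `157α < L⁻²`, `U₀ ∈ histGood θ K J`).  [Balaban1985Averaging] (127)–(128): the `k`-fold linearised average is the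
composition of the one-step ones along the descended backgrounds `U₀^{(i)}`. [cite: Balaban1985Averaging, (127)-(128) p.37, (139) p.39; Balaban1987RG1, (0.11) p.253] -/
theorem fderiv_qRead_tower {J I K : ℕ} (hJI : J ≤ I) (hIK : I ≤ K) {θ : ℕ → ℝ} (hθ0 : ∀ i, 0 ≤ θ i) {α : ℝ}
    (hθα : ∀ i, J < i → i ≤ K → (((5 * F.L : ℕ) : ℝ) ^ 2 / 4) * θ i ≤ α)
    (hα24 : α ≤ 1 / 24) (hαδ : α < deltaSU (Fin 2)) (hαL : 157 * α < ((F.L : ℝ) ^ 2)⁻¹)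
    {U₀ : GaugeField (F.P K) 0 (SU 2)} (hUg : U₀ ∈ histGood F ℰp θ K J) :
    fderiv ℝ (fun (ζ : PBond (F.P K) 0 → EuclideanSpace ℝ (Fin 3)) (B : PBond (F.P J) 0) =>
        imVec (su2Quat (descendTo F ℰp J K (hJI.trans hIK) (fun ℓ => expPoint (ζ ℓ) * U₀ ℓ) B * (descendTo F ℰp J K (hJI.trans hIK) U₀ B)⁻¹))) 0 =
      (fderiv ℝ (fun (y : PBond (F.P I) 0 → EuclideanSpace ℝ (Fin 3)) (B : PBond (F.P J) 0) =>
          imVec (su2Quat (descendTo F ℰp J I hJI (fun b => expPoint (y b) * descendTo F ℰp I K hIK U₀ b) B *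
            (descendTo F ℰp J I hJI (descendTo F ℰp I K hIK U₀) B)⁻¹))) 0).comp
        (fderiv ℝ (fun (ζ : PBond (F.P K) 0 → EuclideanSpace ℝ (Fin 3)) (b : PBond (F.P I) 0) =>
          imVec (su2Quat (descendTo F ℰp I K hIK (fun ℓ => expPoint (ζ ℓ) * U₀ ℓ) b * (descendTo F ℰp I K hIK U₀ b)⁻¹))) 0) := by
  -- guards at the two sub-towers
  have hUgI : U₀ ∈ histGood F ℰp θ K I := histGood_of_le hJI hUg
  have hVg : descendTo F ℰp I K hIK U₀ ∈ histGood F ℰp θ I J := descendTo_mem_histGood hIK hUg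
  have hθαI : ∀ i, I < i → i ≤ K → (((5 * F.L : ℕ) : ℝ) ^ 2 / 4) * θ i ≤ α := fun i hi hiK => hθα i (lt_of_le_of_lt hJI hi) hiK
  have hθαJ : ∀ i, J < i → i ≤ I → (((5 * F.L : ℕ) : ℝ) ^ 2 / 4) * θ i ≤ α := fun i hi hiI => hθα i hi (hiI.trans hIK)
  have hθδI : ∀ i, I < i → i ≤ K → (((5 * F.L : ℕ) : ℝ) ^ 2 / 4) * θ i < deltaSU (Fin 2) := fun i hi hiK => (hθαI i hi hiK).trans_lt hαδ
  -- abbreviations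
  set V := descendTo F ℰp I K hIK U₀ with hVdef
  set MqJK := fun (ζ : PBond (F.P K) 0 → EuclideanSpace ℝ (Fin 3)) (B : PBond (F.P J) 0) =>
      imVec (su2Quat (descendTo F ℰp J K (hJI.trans hIK) (fun ℓ => expPoint (ζ ℓ) * U₀ ℓ) B * (descendTo F ℰp J K (hJI.trans hIK) U₀ B)⁻¹)) with hMqJK
  set MqJI := fun (y : PBond (F.P I) 0 → EuclideanSpace ℝ (Fin 3)) (B : PBond (F.P J) 0) =>
      imVec (su2Quat (descendTo F ℰp J I hJI (fun b => expPoint (y b) * V b) B * (descendTo F ℰp J I hJI V B)⁻¹)) with hMqJI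
  set MqIK := fun (ζ : PBond (F.P K) 0 → EuclideanSpace ℝ (Fin 3)) (b : PBond (F.P I) 0) =>
      imVec (su2Quat (descendTo F ℰp I K hIK (fun ℓ => expPoint (ζ ℓ) * U₀ ℓ) b * (descendTo F ℰp I K hIK U₀ b)⁻¹)) with hMqIK
  set McIK := fun (ζ : PBond (F.P K) 0 → EuclideanSpace ℝ (Fin 3)) (b : PBond (F.P I) 0) =>
      (isChartRep_specialUnitaryGroup (n := Fin 2)).logChart
        (descendTo F ℰp I K hIK (fun ℓ => expPoint (ζ ℓ) * U₀ ℓ) b * (descendTo F ℰp I K hIK U₀ b)⁻¹) with hMcIK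
  have hMc0 : McIK 0 = 0 := chartRead_descendTo_expPoint_apply_zero (F := F) hIK U₀
  -- the three strict derivatives
  obtain ⟨hDJI, -, -⟩ := hasStrictFDerivAt_qRead_descendTo (F := F) hJI hθ0 hθαJ hα24 hαδ hαL hVg
  obtain ⟨-, -, hqE⟩ := hasStrictFDerivAt_qRead_descendTo (F := F) hIK hθ0 hθαI hα24 hαδ hαL hUgI
  obtain ⟨hMc, -⟩ := hasStrictFDerivAt_chartRead_descendTo_expPoint (F := F) hIK hθ0 hθαI hα24 hαδ hαL hUgI
  obtain ⟨E, hE⟩ := exists_coordEquiv (F.P I) 0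
  have hEs : HasStrictFDerivAt (⇑E.symm) (E.symm : (PBond (F.P I) 0 → (specialUnitaryLogChart (Fin 2)).lie) →L[ℝ]
      (PBond (F.P I) 0 → EuclideanSpace ℝ (Fin 3))) (McIK 0) :=
    ContinuousLinearEquiv.hasStrictFDerivAt (𝕜 := ℝ) (E := PBond (F.P I) 0 → (specialUnitaryLogChart (Fin 2)).lie)
      (F := PBond (F.P I) 0 → EuclideanSpace ℝ (Fin 3)) (x := McIK 0) E.symm
  have h1 := HasStrictFDerivAt.comp (𝕜 := ℝ) (0 : PBond (F.P K) 0 → EuclideanSpace ℝ (Fin 3)) (f := McIK) (f' := fderiv ℝ McIK 0) (g := ⇑E.symm)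
    (g' := (E.symm : (PBond (F.P I) 0 → (specialUnitaryLogChart (Fin 2)).lie) →L[ℝ] (PBond (F.P I) 0 → EuclideanSpace ℝ (Fin 3)))) hEs hMc
  have hz : E.symm (McIK 0) = 0 := by rw [hMc0, map_zero]
  have hDJI' : HasStrictFDerivAt MqJI (fderiv ℝ MqJI 0) (E.symm (McIK 0)) := by rw [hz]; exact hDJI
  have h2 := HasStrictFDerivAt.comp (0 : PBond (F.P K) 0 → EuclideanSpace ℝ (Fin 3)) (f := fun ζ => E.symm (McIK ζ)) (g := MqJI) hDJI' h1
  have heq := qRead_tower_eventuallyEq (F := F) hJI hIK hθ0 hθδI hUgI E hE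
  have h3 : HasStrictFDerivAt MqJK ((fderiv ℝ MqJI 0).comp ((E.symm : (PBond (F.P I) 0 → (specialUnitaryLogChart (Fin 2)).lie) →L[ℝ]
      (PBond (F.P I) 0 → EuclideanSpace ℝ (Fin 3))).comp (fderiv ℝ McIK 0))) 0 := h2.congr_of_eventuallyEq heq.symm
  rw [h3.hasFDerivAt.fderiv, hqE E hE]

/-- **`DMq_{K←K}(V) = id`**: the zero-step quaternion-read descent is the bond-wise chart read `ζ ↦ (B ↦ imVec (su2Quat (expPoint (ζ B))))` (`D_{K,K} = id`, lit ✓`descendTo_self`),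
tangent to the identity (✓`hasStrictFDerivAt_pi_imVec_su2Quat_expPoint`). [cite: Balaban1985UV3, p. 260 (bookkeeping)] -/
theorem fderiv_qRead_self {K : ℕ} (V : GaugeField (F.P K) 0 (SU 2)) :
    fderiv ℝ (fun (ζ : PBond (F.P K) 0 → EuclideanSpace ℝ (Fin 3)) (B : PBond (F.P K) 0) =>
        imVec (su2Quat (descendTo F ℰp K K le_rfl (fun ℓ => expPoint (ζ ℓ) * V ℓ) B * (descendTo F ℰp K K le_rfl V B)⁻¹))) 0 =
      ContinuousLinearMap.id ℝ (PBond (F.P K) 0 → EuclideanSpace ℝ (Fin 3)) := by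
  have hfun : (fun (ζ : PBond (F.P K) 0 → EuclideanSpace ℝ (Fin 3)) (B : PBond (F.P K) 0) =>
      imVec (su2Quat (descendTo F ℰp K K le_rfl (fun ℓ => expPoint (ζ ℓ) * V ℓ) B * (descendTo F ℰp K K le_rfl V B)⁻¹))) =
      fun (ζ : PBond (F.P K) 0 → EuclideanSpace ℝ (Fin 3)) (B : PBond (F.P K) 0) => imVec (su2Quat (expPoint (ζ B))) := by
    funext ζ B
    rw [descendTo_self, descendTo_self, mul_inv_cancel_right]
  rw [hfun]
  exact (hasStrictFDerivAt_pi_imVec_su2Quat_expPoint (PBond (F.P K) 0)).hasFDerivAt.fderiv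

end ChainRule

/-! ## §2 The exact second-order telescope -/

section Telescope

/-- ★★★ **THE EXACT SECOND-ORDER TELESCOPE** over the `k`-step tower `K = J + k` at a good history `U₀` (Q1's guard at `(J, J+k)`): for EVERY family of vectors
`x_t ∈ (PBond (F.P (J+t)) 0 → ℝ³)`,
`x_0 − DMq_{J←J+k}(U₀) x_k = Σ_{t<k} DMq_{J←J+t}(D_{J+t,J+k}U₀) (x_t − DMq_{J+t←J+t+1}(D_{J+t+1,J+k}U₀) x_{t+1})`
(with `T_t := DMq_{J←J+t}(D_{J+t,J+k}U₀)`, `S_t := DMq_{J+t←J+t+1}(D_{J+t+1,J+k}U₀)`: `T_{t+1} = T_t ∘L S_t`, `T_0 = id`, `T_k = DMq_{J←J+k}(U₀)`, and the sum telescopes; the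
summand is guarded by `t < k` so that the level proofs are in scope — on `Finset.range k` the guard always holds).
[cite: Balaban1985Averaging, (127)-(128) p.37, (148)-(149) p.40 (bookkeeping)] -/
theorem qRead_tower_telescope {J : ℕ} {θ : ℕ → ℝ} (hθ0 : ∀ i, 0 ≤ θ i) {α : ℝ}
    (hα24 : α ≤ 1 / 24) (hαδ : α < deltaSU (Fin 2)) (hαL : 157 * α < ((F.L : ℝ) ^ 2)⁻¹) :
    ∀ (k : ℕ) {U₀ : GaugeField (F.P (J + k)) 0 (SU 2)},
      (∀ i, J < i → i ≤ J + k → (((5 * F.L : ℕ) : ℝ) ^ 2 / 4) * θ i ≤ α) → U₀ ∈ histGood F ℰp θ (J + k) J →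
      ∀ x : (t : ℕ) → (PBond (F.P (J + t)) 0 → EuclideanSpace ℝ (Fin 3)),
        x 0 - (fderiv ℝ (fun (ζ : PBond (F.P (J + k)) 0 → EuclideanSpace ℝ (Fin 3)) (B : PBond (F.P J) 0) =>
            imVec (su2Quat (descendTo F ℰp J (J + k) (Nat.le_add_right J k) (fun ℓ => expPoint (ζ ℓ) * U₀ ℓ) B *
              (descendTo F ℰp J (J + k) (Nat.le_add_right J k) U₀ B)⁻¹))) 0) (x k) =
          ∑ t ∈ Finset.range k, if ht : t < k then
            (fderiv ℝ (fun (y : PBond (F.P (J + t)) 0 → EuclideanSpace ℝ (Fin 3)) (B : PBond (F.P J) 0) =>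
                imVec (su2Quat (descendTo F ℰp J (J + t) (Nat.le_add_right J t)
                  (fun b => expPoint (y b) * descendTo F ℰp (J + t) (J + k) (Nat.add_le_add_left ht.le J) U₀ b) B *
                  (descendTo F ℰp J (J + t) (Nat.le_add_right J t) (descendTo F ℰp (J + t) (J + k) (Nat.add_le_add_left ht.le J) U₀) B)⁻¹))) 0)
              (x t - (fderiv ℝ (fun (w : PBond (F.P (J + (t + 1))) 0 → EuclideanSpace ℝ (Fin 3)) (b : PBond (F.P (J + t)) 0) =>
                  imVec (su2Quat (descendTo F ℰp (J + t) (J + (t + 1)) (Nat.add_le_add_left (Nat.le_succ t) J)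
                    (fun ℓ => expPoint (w ℓ) * descendTo F ℰp (J + (t + 1)) (J + k) (Nat.add_le_add_left (Nat.succ_le_of_lt ht) J) U₀ ℓ) b *
                    (descendTo F ℰp (J + t) (J + (t + 1)) (Nat.add_le_add_left (Nat.le_succ t) J)
                      (descendTo F ℰp (J + (t + 1)) (J + k) (Nat.add_le_add_left (Nat.succ_le_of_lt ht) J) U₀) b)⁻¹))) 0)
                (x (t + 1)))
            else 0 := by
  intro k
  induction k with
  | zero =>
    intro U₀ _ _ x
    rw [Finset.sum_range_zero]
    have h1 := fderiv_qRead_self (F := F) (K := J) U₀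
    have h2 : ∀ v : PBond (F.P J) 0 → EuclideanSpace ℝ (Fin 3),
        (fderiv ℝ (fun (ζ : PBond (F.P J) 0 → EuclideanSpace ℝ (Fin 3)) (B : PBond (F.P J) 0) =>
          imVec (su2Quat (descendTo F ℰp J J le_rfl (fun ℓ => expPoint (ζ ℓ) * U₀ ℓ) B * (descendTo F ℰp J J le_rfl U₀ B)⁻¹))) 0) v = v := fun v => by
      rw [h1, ContinuousLinearMap.coe_id', id_eq]
    exact sub_eq_zero.mpr (h2 (x 0)).symm
  | succ k ih =>
    intro U₀ hθα hUg x
    have hIK : J + k ≤ J + (k + 1) := Nat.add_le_add_left (Nat.le_succ k) J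
    -- peel the top step `I := J + k`: `T_{k+1} = T_k(V) ∘L S_k`, so `x₀ − T_{k+1} x_{k+1} = (x₀ − T_k(V) x_k) + T_k(V) (x_k − S_k x_{k+1})`
    have hpeel : ∀ (T : (PBond (F.P (J + k)) 0 → EuclideanSpace ℝ (Fin 3)) →L[ℝ] (PBond (F.P J) 0 → EuclideanSpace ℝ (Fin 3)))
        (S : (PBond (F.P (J + (k + 1))) 0 → EuclideanSpace ℝ (Fin 3)) →L[ℝ] (PBond (F.P (J + k)) 0 → EuclideanSpace ℝ (Fin 3))),
        x 0 - (T.comp S) (x (k + 1)) = (x 0 - T (x k)) + T (x k - S (x (k + 1))) := fun T S => by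
      rw [ContinuousLinearMap.comp_apply, map_sub]; abel
    rw [fderiv_qRead_tower (F := F) (Nat.le_add_right J k) hIK hθ0 hθα hα24 hαδ hαL hUg, hpeel, Finset.sum_range_succ,
      dif_pos (Nat.lt_succ_self k)]
    -- the descended base is a good history of the `k`-step tower
    have hVg : descendTo F ℰp (J + k) (J + (k + 1)) hIK U₀ ∈ histGood F ℰp θ (J + k) J := descendTo_mem_histGood hIK hUg
    have hθα' : ∀ i, J < i → i ≤ J + k → (((5 * F.L : ℕ) : ℝ) ^ 2 / 4) * θ i ≤ α := fun i hi hik => hθα i hi (hik.trans hIK)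
    rw [ih hθα' hVg x]
    congr 1
    · refine Finset.sum_congr rfl fun t ht => ?_
      rw [Finset.mem_range] at ht
      rw [dif_pos ht, dif_pos (Nat.lt_succ_of_lt ht)]
      simp only [descendTo_descendTo]
    · simp only [descendTo_self]

end Telescope

/-! ## §3 The chords of a pair down the tower: the remainder of the k-step read is the telescope of one-step defects; the fibre identity -/

section Chords

/-- ★★ **THE DESCENT AT THE EXACT CHART COORDINATES OF `W` RELATIVE TO `V` RETURNS THE COARSE imVec CHORD**: with `η̃ ℓ := logVec (su2Quat (W ℓ·V ℓ⁻¹))` (lit ✓`expPoint_logVec`: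
`expPoint (η̃ ℓ)·V ℓ = W ℓ` for EVERY pair, no smallness), `Mq_{J←K}(V) η̃ = (B ↦ imVec (su2Quat (D_{J,K}W B·D_{J,K}V B⁻¹)))`.  Consequently each bracket of ✓`qRead_tower_telescope` at the
chords of a pair IS «`DMq^{one}`(fine imVec chord) − `Mq^{one}`(fine logVec chord)», the one-step second-order linearisation defect that [Balaban1985Averaging] Prop. 3 (123) sizes
for the printed average. [cite: Balaban1985Averaging, Prop. 3 (122)-(123) p.36; Balaban1987RG1, (0.11) p.253] -/
theorem qRead_apply_logVec_chord {J K : ℕ} (hJK : J ≤ K) (W V : GaugeField (F.P K) 0 (SU 2)) :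
    (fun (ζ : PBond (F.P K) 0 → EuclideanSpace ℝ (Fin 3)) (B : PBond (F.P J) 0) =>
        imVec (su2Quat (descendTo F ℰp J K hJK (fun ℓ => expPoint (ζ ℓ) * V ℓ) B * (descendTo F ℰp J K hJK V B)⁻¹)))
        (fun ℓ => logVec (su2Quat (W ℓ * (V ℓ)⁻¹))) =
      fun B : PBond (F.P J) 0 => imVec (su2Quat (descendTo F ℰp J K hJK W B * (descendTo F ℰp J K hJK V B)⁻¹)) := by
  have hW : (fun ℓ => expPoint (logVec (su2Quat (W ℓ * (V ℓ)⁻¹))) * V ℓ : GaugeField (F.P K) 0 (SU 2)) = W := by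
    funext ℓ; rw [expPoint_logVec, inv_mul_cancel_right]
  funext B
  simp only [hW]

/-- ★★★ **THE SECOND-ORDER REMAINDER OF THE k-STEP READ IS THE TELESCOPE OF ONE-STEP LINEARISATION DEFECTS** (`K = J + k`, Q1's guard at `(J,K)` on the base `U₀`; the partner
`W` is ARBITRARY — no fibre condition, no smallness): with the imVec chords of the descended pair `η⁽ᵗ⁾ ℓ := imVec (su2Quat (D_{J+t,K}W ℓ·D_{J+t,K}U₀ ℓ⁻¹))` at every level,
`η⁽⁰⁾ − DMq_{J←K}(U₀) η⁽ᵏ⁾ = Σ_{t<k} DMq_{J←J+t}(D_{J+t,K}U₀) (η⁽ᵗ⁾ − DMq_{J+t←J+t+1}(D_{J+t+1,K}U₀) η⁽ᵗ⁺¹⁾)`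
(`η⁽ᵏ⁾ ℓ = imVec (su2Quat (W ℓ·U₀ ℓ⁻¹))`; for `W = expPoint ζ • U₀`: `η⁽⁰⁾ = Mq_{J←K}(U₀) ζ` by definition and `η⁽ᵏ⁾ ℓ = imVec (su2Quat (expPoint (ζ ℓ))) = sinc‖ζ ℓ‖ • ζ ℓ`, so the
left side IS the vector of px17 g22's TAYLOR♭_q (✓`…QuaternionReadFibreIdentity.avg2_of_taylor`), now written as propagated ONE-STEP brackets «actual coarse chord minus linearised
one-step average of the fine chord» — the CONSUMER SHAPE of the (β) brick). [cite: Balaban1985Averaging, Prop. 3 (123) p.36, (127)-(128) p.37, (148)-(149) p.40; Balaban1987RG1, (0.11) p.253] -/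
theorem chord_sub_fderiv_qRead_chord_eq_sum {J : ℕ} {θ : ℕ → ℝ} (hθ0 : ∀ i, 0 ≤ θ i) {α : ℝ}
    (hα24 : α ≤ 1 / 24) (hαδ : α < deltaSU (Fin 2)) (hαL : 157 * α < ((F.L : ℝ) ^ 2)⁻¹) (k : ℕ) {U₀ : GaugeField (F.P (J + k)) 0 (SU 2)}
    (hθα : ∀ i, J < i → i ≤ J + k → (((5 * F.L : ℕ) : ℝ) ^ 2 / 4) * θ i ≤ α) (hUg : U₀ ∈ histGood F ℰp θ (J + k) J)
    (W : GaugeField (F.P (J + k)) 0 (SU 2)) :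
    (fun B : PBond (F.P J) 0 => imVec (su2Quat (descendTo F ℰp J (J + k) (Nat.le_add_right J k) W B *
        (descendTo F ℰp J (J + k) (Nat.le_add_right J k) U₀ B)⁻¹))) -
      (fderiv ℝ (fun (ζ : PBond (F.P (J + k)) 0 → EuclideanSpace ℝ (Fin 3)) (B : PBond (F.P J) 0) =>
          imVec (su2Quat (descendTo F ℰp J (J + k) (Nat.le_add_right J k) (fun ℓ => expPoint (ζ ℓ) * U₀ ℓ) B *
            (descendTo F ℰp J (J + k) (Nat.le_add_right J k) U₀ B)⁻¹))) 0)
        (fun ℓ => imVec (su2Quat (W ℓ * (U₀ ℓ)⁻¹))) =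
      ∑ t ∈ Finset.range k, if ht : t < k then
        (fderiv ℝ (fun (y : PBond (F.P (J + t)) 0 → EuclideanSpace ℝ (Fin 3)) (B : PBond (F.P J) 0) =>
            imVec (su2Quat (descendTo F ℰp J (J + t) (Nat.le_add_right J t)
              (fun b => expPoint (y b) * descendTo F ℰp (J + t) (J + k) (Nat.add_le_add_left ht.le J) U₀ b) B *
              (descendTo F ℰp J (J + t) (Nat.le_add_right J t) (descendTo F ℰp (J + t) (J + k) (Nat.add_le_add_left ht.le J) U₀) B)⁻¹))) 0)
          ((fun b => imVec (su2Quat (descendTo F ℰp (J + t) (J + k) (Nat.add_le_add_left ht.le J) W b *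
              (descendTo F ℰp (J + t) (J + k) (Nat.add_le_add_left ht.le J) U₀ b)⁻¹))) -
            (fderiv ℝ (fun (w : PBond (F.P (J + (t + 1))) 0 → EuclideanSpace ℝ (Fin 3)) (b : PBond (F.P (J + t)) 0) =>
                imVec (su2Quat (descendTo F ℰp (J + t) (J + (t + 1)) (Nat.add_le_add_left (Nat.le_succ t) J)
                  (fun ℓ => expPoint (w ℓ) * descendTo F ℰp (J + (t + 1)) (J + k) (Nat.add_le_add_left (Nat.succ_le_of_lt ht) J) U₀ ℓ) b *
                  (descendTo F ℰp (J + t) (J + (t + 1)) (Nat.add_le_add_left (Nat.le_succ t) J)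
                    (descendTo F ℰp (J + (t + 1)) (J + k) (Nat.add_le_add_left (Nat.succ_le_of_lt ht) J) U₀) b)⁻¹))) 0)
              (fun ℓ => imVec (su2Quat (descendTo F ℰp (J + (t + 1)) (J + k) (Nat.add_le_add_left (Nat.succ_le_of_lt ht) J) W ℓ *
                (descendTo F ℰp (J + (t + 1)) (J + k) (Nat.add_le_add_left (Nat.succ_le_of_lt ht) J) U₀ ℓ)⁻¹))))
        else 0 := by
  -- the chord family of the descended pair, extended by `0` above the top (never read there)
  set X : (t : ℕ) → (PBond (F.P (J + t)) 0 → EuclideanSpace ℝ (Fin 3)) := fun t =>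
    if h : t ≤ k then
      (fun ℓ => imVec (su2Quat (descendTo F ℰp (J + t) (J + k) (Nat.add_le_add_left h J) W ℓ *
        (descendTo F ℰp (J + t) (J + k) (Nat.add_le_add_left h J) U₀ ℓ)⁻¹)))
    else 0 with hX
  have htel := qRead_tower_telescope (F := F) (J := J) hθ0 hα24 hαδ hαL k hθα hUg X
  have hx0 : X 0 = fun B : PBond (F.P J) 0 => imVec (su2Quat (descendTo F ℰp J (J + k) (Nat.le_add_right J k) W B *
      (descendTo F ℰp J (J + k) (Nat.le_add_right J k) U₀ B)⁻¹)) := by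
    rw [hX]; dsimp only; rw [dif_pos (Nat.zero_le k)]; rfl
  have hxk : X k = fun ℓ => imVec (su2Quat (W ℓ * (U₀ ℓ)⁻¹)) := by
    rw [hX]; dsimp only; rw [dif_pos le_rfl]; funext ℓ; rw [descendTo_self, descendTo_self]
  rw [hx0, hxk] at htel
  rw [htel]
  refine Finset.sum_congr rfl fun t ht => ?_
  rw [Finset.mem_range] at ht
  rw [dif_pos ht, dif_pos ht, hX]; dsimp only; rw [dif_pos ht.le, dif_pos (Nat.succ_le_of_lt ht)]

/-- ★★★ **THE k-STEP FIBRE IDENTITY OF AVG₂♭-ax_q, LEVEL BY LEVEL** (`K = J + k`): for a fibre mate `U` of the base `U₀` (`D_{J,K}U = D_{J,K}U₀`; the level-`J` chord vanishes —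
px17 g22's Q6 ✓`…QuaternionReadFibreIdentity.qRead_eq_zero_of_mem_fibre` at the exact coordinates ✓`expPoint_logChord_mul`), with `η⁽ᵗ⁾` the imVec chords of the descended pair,
`DMq_{J←K}(U₀) η⁽ᵏ⁾ = Σ_{t<k} DMq_{J←J+t}(D_{J+t,K}U₀) (DMq_{J+t←J+t+1}(D_{J+t+1,K}U₀) η⁽ᵗ⁺¹⁾ − η⁽ᵗ⁾)`, `η⁽ᵏ⁾ ℓ = imVec (su2Quat (U ℓ·U₀ ℓ⁻¹))` = the letter's OWN input
(text of record ✓p825995's `hM`): AVG₂♭-ax_q's vector IS the sum of the propagated one-step linearisation defects; no chart conversion at the k-step level.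
[cite: Balaban1985Averaging, Prop. 3 (123) p.36, (127)-(128) p.37, (148)-(149) p.40; Balaban1987RG1, (0.11) p.253] -/
theorem fderiv_qRead_chord_eq_sum_of_mem_fibre {J : ℕ} {θ : ℕ → ℝ} (hθ0 : ∀ i, 0 ≤ θ i) {α : ℝ}
    (hα24 : α ≤ 1 / 24) (hαδ : α < deltaSU (Fin 2)) (hαL : 157 * α < ((F.L : ℝ) ^ 2)⁻¹) (k : ℕ) {U₀ : GaugeField (F.P (J + k)) 0 (SU 2)}
    (hθα : ∀ i, J < i → i ≤ J + k → (((5 * F.L : ℕ) : ℝ) ^ 2 / 4) * θ i ≤ α) (hUg : U₀ ∈ histGood F ℰp θ (J + k) J)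
    {U : GaugeField (F.P (J + k)) 0 (SU 2)} (hU : U ∈ fibre F ℰp J (J + k) (Nat.le_add_right J k) (descendTo F ℰp J (J + k) (Nat.le_add_right J k) U₀)) :
    (fderiv ℝ (fun (ζ : PBond (F.P (J + k)) 0 → EuclideanSpace ℝ (Fin 3)) (B : PBond (F.P J) 0) =>
        imVec (su2Quat (descendTo F ℰp J (J + k) (Nat.le_add_right J k) (fun ℓ => expPoint (ζ ℓ) * U₀ ℓ) B *
          (descendTo F ℰp J (J + k) (Nat.le_add_right J k) U₀ B)⁻¹))) 0)
        (fun ℓ => imVec (su2Quat (U ℓ * (U₀ ℓ)⁻¹))) =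
      ∑ t ∈ Finset.range k, if ht : t < k then
        (fderiv ℝ (fun (y : PBond (F.P (J + t)) 0 → EuclideanSpace ℝ (Fin 3)) (B : PBond (F.P J) 0) =>
            imVec (su2Quat (descendTo F ℰp J (J + t) (Nat.le_add_right J t)
              (fun b => expPoint (y b) * descendTo F ℰp (J + t) (J + k) (Nat.add_le_add_left ht.le J) U₀ b) B *
              (descendTo F ℰp J (J + t) (Nat.le_add_right J t) (descendTo F ℰp (J + t) (J + k) (Nat.add_le_add_left ht.le J) U₀) B)⁻¹))) 0)
          ((fderiv ℝ (fun (w : PBond (F.P (J + (t + 1))) 0 → EuclideanSpace ℝ (Fin 3)) (b : PBond (F.P (J + t)) 0) =>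
              imVec (su2Quat (descendTo F ℰp (J + t) (J + (t + 1)) (Nat.add_le_add_left (Nat.le_succ t) J)
                (fun ℓ => expPoint (w ℓ) * descendTo F ℰp (J + (t + 1)) (J + k) (Nat.add_le_add_left (Nat.succ_le_of_lt ht) J) U₀ ℓ) b *
                (descendTo F ℰp (J + t) (J + (t + 1)) (Nat.add_le_add_left (Nat.le_succ t) J)
                  (descendTo F ℰp (J + (t + 1)) (J + k) (Nat.add_le_add_left (Nat.succ_le_of_lt ht) J) U₀) b)⁻¹))) 0)
            (fun ℓ => imVec (su2Quat (descendTo F ℰp (J + (t + 1)) (J + k) (Nat.add_le_add_left (Nat.succ_le_of_lt ht) J) U ℓ *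
              (descendTo F ℰp (J + (t + 1)) (J + k) (Nat.add_le_add_left (Nat.succ_le_of_lt ht) J) U₀ ℓ)⁻¹))) -
          (fun b => imVec (su2Quat (descendTo F ℰp (J + t) (J + k) (Nat.add_le_add_left ht.le J) U b *
              (descendTo F ℰp (J + t) (J + k) (Nat.add_le_add_left ht.le J) U₀ b)⁻¹))))
        else 0 := by
  have htel := chord_sub_fderiv_qRead_chord_eq_sum (F := F) (J := J) hθ0 hα24 hαδ hαL k hθα hUg U
  -- the level-`J` chord of a fibre mate vanishes (px17 g22's Q6, at the exact coordinates of `U` over `U₀`)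
  have hζ : (fun ℓ => expPoint (logVec (su2Quat (U ℓ * (U₀ ℓ)⁻¹))) * U₀ ℓ : GaugeField (F.P (J + k)) 0 (SU 2)) ∈
      fibre F ℰp J (J + k) (Nat.le_add_right J k) (descendTo F ℰp J (J + k) (Nat.le_add_right J k) U₀) := by
    rw [expPoint_logChord_mul]; exact hU
  have h0 := qRead_eq_zero_of_mem_fibre (Nat.le_add_right J k) ((mem_fibre_iff F ℰp).mpr rfl) hζ
  rw [expPoint_logChord_mul] at h0
  rw [h0, zero_sub, neg_eq_iff_eq_neg, ← Finset.sum_neg_distrib] at htel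
  rw [htel]
  refine Finset.sum_congr rfl fun t ht => ?_
  rw [Finset.mem_range] at ht
  rw [dif_pos ht, dif_pos ht, ← map_neg, neg_sub]

end Chords

end Summit.QuantumFields.YangMills.Theorems.FluctuationComparisonRegPrIntLS2BetaQuaternionReadTowerTelescope

end
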